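import Summits.PneNP.PneNP.Theorems.SymmetryBudgetNoHiddenOrderPerPathReplayRuns

/-!
# Pointer runs along the solution subtree: the label-driven replay of EVERY vertex of a reached block ends in that block's colouring

Route `PneNP/SymmetryBudget`, `NoHiddenOrder` (stmt-PneNP-14781). The bridge between the function-level certified-label scheme on the
components-only Corneil–Goldberg process (`…PerPathCG*.lean`: `cgProcess`, `cgValuation`, completeness along
`CertifiedLabels.Reach (cgProcess G) cgSel (hgt G cgSel) I₀`) and the symmetric replay circuit of (R2c) (`…ReplayRoot.lean`: from the input
matrix, the state wires of the replay module of a POINTER `v` read `BranchSum.replay G S hgt v k (atom G W col₀ v, col₀)` =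
`replay G S hgt v k (St G I₀ v)` for `I₀ = (W, col₀)`).

A symmetric circuit cannot follow "the" lineage of a label `(U, X, λ)`; it runs the label-driven replay once per pointer `v ∈ U`. This file
proves that along the solution subtree all these runs are RIGHT: for every reached label `(I, X, λ)` (selector `cgSel`, values the pass-over
heights `hgt`, start block with an equitable colouring), every vertex `v` of the block `I.1.1` and every fuel `F ≥ |V|`,

* `reach_replay_snd_eq`:       `(replay G X λ v F (St G I₀ v)).2 = I.1.2` — the run of `v` ends with the colouring of `I` (as a global function);
* `reach_replay_eq_of_not_mem`: for an UNNAMED `v ∉ X` the final block is the atom of `v` in `I`: `replay … = (atom G I.1.1 I.1.2 v, I.1.2)`;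
* `reach_replay_eq_of_mem`:     for a NAMED `v ∈ X` the run has just individualised `v` itself and sits at `({v}, I.1.2)`.

Ingredients (`…PerPathReplayRuns.lean`): the replay algebra, replay exactness when the LAST choice may be the pointer, atoms of iterates and of
switching-isolated vertices; here the invariant `reach_pointer` along `Reach` (timed-path data with HEIGHT-COLOUREDNESS, obtained from (C1′)
`hgt_lt_of_reachFrom` through node data remembered for every timed step: `NodeData`, `UData`, `NData`) and the three run theorems.
-/

-- `Summit.PneNP.PneNP.…` duplicates `PneNP` BY DESIGN (single-problem summit, D-0017 layout).
set_option linter.dupNamespace false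

namespace Summit.PneNP.PneNP.Theorems

open Finset

namespace BranchSum

variable {V : Type*} [DecidableEq V] {G : SimpleGraph V} [DecidableRel G.Adj]

/-! ### The invariant of every pointer along the solution subtree -/

section Pointer

variable [Fintype V] (G) (I₀ : CGInst V)

omit [Fintype V] in
/-- One more OR-choice: the enumeration of the named set. -/
theorem insert_eq_image_range_succ {x x' : ℕ → V} {t : ℕ} {z : V} (hagx : ∀ k, k < t → x' k = x k) (hxt : x' t = z)
    {X : Finset V} (hX : X = (range t).image x) : insert z X = (range (t + 1)).image x' := by
  rw [range_add_one, image_insert, hxt, hX]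
  congr 1
  exact (image_congr fun k hk => hagx k (mem_range.1 (mem_coe.1 hk))).symm

/-- **NODE DATA** of a timed path `x` of length `t` for the pointer `v` at the node `(I, X, λ)`: for every step `k < t` an individualisation
node of the process whose cell is the cell of `x k` in the `k`-th timed state, whose height is the recorded value `λ (x k)`, and from whose
child the node `(I, X, λ)` is reached in the solution subtree (so (C1′) `hgt_lt_of_reachFrom` applies to it). -/
def NodeData (I : CGInst V) (X : Finset V) (lam : V → ℕ) (v : V) (t : ℕ) (x : ℕ → V) : Prop :=
  ∀ k, k < t → ∃ (ν : CGInst V) (A : Finset V) (ch : V → CGInst V) (X' : Finset V) (lam' : V → ℕ),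
    cgStep G ν = .orNode A ch ∧ A = cellOf (timed G v (St G I₀ v) x k).1 (timed G v (St G I₀ v) x k).2 (x k) ∧
    lam (x k) = hgt G cgSel ν ∧
    CertifiedLabels.ReachFrom (P := cgProcess G) cgSel (hgt G cgSel) (ch (cgSel ν)) X' lam' I X lam

/-- **Data of an UNNAMED pointer** `v ∉ X` of the block at `(I, X, λ)`: a timed path of OR-choices avoiding `v` whose last colouring is the
colouring of `I`, whose block before the last OR-node iterates to the block of `I`, whose choices enumerate `X`, which is HEIGHT-COLOURED by
`λ`, with node data. (`InvData` of `…PerPathCGBudget` plus the last two.) -/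
def UData (I : CGInst V) (X : Finset V) (lam : V → ℕ) (v : V) : Prop :=
  ∃ (t : ℕ) (x : ℕ → V), IsORChoice G v (St G I₀ v) x t ∧ (∀ k, k < t → x k ≠ v) ∧
    I.1.2 = (timed G v (St G I₀ v) x t).2 ∧ (∃ i, I.1.1 = (fun B => swReach G B I.1.2 v)^[i] (pre G I₀ v x t)) ∧
    X = (range t).image x ∧ HeightColoured G v (St G I₀ v) x t lam ∧ NodeData G I₀ I X lam v t x

/-- **Data of a NAMED pointer** `v ∈ X` of the block at `(I, X, λ)`: a timed path of `t + 1` OR-choices the last of which is `v` itself (the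
earlier ones avoid `v`), whose last colouring is the colouring of `I`, whose block before the last OR-node contains the block of `I`, whose
choices enumerate `X`, height-coloured by `λ`. -/
def NData (I : CGInst V) (X : Finset V) (lam : V → ℕ) (v : V) : Prop :=
  ∃ (t : ℕ) (x : ℕ → V), IsORChoice G v (St G I₀ v) x (t + 1) ∧ x t = v ∧ (∀ k, k < t → x k ≠ v) ∧
    I.1.2 = (timed G v (St G I₀ v) x (t + 1)).2 ∧ I.1.1 ⊆ (timed G v (St G I₀ v) x t).1 ∧
    X = (range (t + 1)).image x ∧ HeightColoured G v (St G I₀ v) x (t + 1) lam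

variable {G I₀}

/-- **The pointer invariant along the solution subtree** (selector `cgSel`, values the heights `hgt`): every unnamed vertex of the block
carries `UData`, every named one `NData`. -/
theorem reach_pointer {I : (cgProcess G).Inst} {X : Finset V} {lam : V → ℕ}
    (h : CertifiedLabels.Reach (cgProcess G) (cgSel (V := V)) (hgt G cgSel) I₀ I X lam) :
    ∀ v ∈ I.1.1, (v ∉ X → UData G I₀ I X lam v) ∧ (v ∈ X → NData G I₀ I X lam v) := by
  induction h with
  | root =>
    intro v _
    refine ⟨fun _ => ⟨0, fun _ => v, fun k hk => absurd hk (Nat.not_lt_zero k), fun k hk => absurd hk (Nat.not_lt_zero k), rfl,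
      ⟨0, rfl⟩, by simp, fun k i _ hi _ => absurd hi (Nat.not_lt_zero i), fun k hk => absurd hk (Nat.not_lt_zero k)⟩,
      fun hX => absurd hX (notMem_empty v)⟩
  | @part I X lam ps J hR hs hJ ih =>
    change CGInst V at I J
    obtain ⟨-, rfl⟩ := cgStep_eq_andNode_iff.1 hs
    obtain ⟨hcolJ, hK⟩ := mem_cgParts_iff.1 hJ
    obtain ⟨w, hw, hKw⟩ := mem_image.1 hK
    intro v hv
    have hv' : v ∈ swReach G I.1.1 I.1.2 w := hKw ▸ hv
    have hvI : v ∈ I.1.1 := swReach_subset _ _ w hv'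
    have hJI : J.1.1 ⊆ I.1.1 := fun u hu => swReach_subset _ _ w (hKw ▸ hu)
    obtain ⟨ihU, ihN⟩ := ih v hvI
    refine ⟨fun hvX => ?_, fun hvX => ?_⟩
    · obtain ⟨t, x, hORc, hxv, hcol, ⟨i, hi⟩, hX, hHC, hND⟩ := ihU hvX
      refine ⟨t, x, hORc, hxv, hcolJ.trans hcol, ⟨i + 1, ?_⟩, hX, hHC, fun k hk => ?_⟩
      · rw [hcolJ, Function.iterate_succ_apply', ← hi, ← hKw]
        exact (swReach_eq_of_mem _ hw hv').symm
      · obtain ⟨ν, A, ch, X', lam', hsν, hA, hlam, hRF⟩ := hND k hk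
        exact ⟨ν, A, ch, X', lam', hsν, hA, hlam, hRF.snoc_part hs hJ⟩
    · obtain ⟨t, x, hORc, hxt, hxv, hcol, hsub, hX, hHC⟩ := ihN hvX
      exact ⟨t, x, hORc, hxt, hxv, hcolJ.trans hcol, hJI.trans hsub, hX, hHC⟩
  | @child I X lam A ch hR hs ih =>
    change CGInst V at I
    have hx₀A : cgSel I ∈ A := cgSel_mem I _ _ hs
    have hfresh : cgSel I ∉ X := cgSel_fresh cgSel_mem I X lam A ch hR hs
    obtain ⟨hAND, hOR, rfl, rfl⟩ := cgStep_eq_orNode_iff.1 hs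
    have hconn : ∀ u ∈ I.1.1, swReach G I.1.1 I.1.2 u = I.1.1 := fun u hu => by
      by_contra hne; exact hAND ⟨u, hu, hne⟩
    -- no vertex of the block of an individualisation node is named: named vertices are singleton cells, cells here have `≥ 2` elements
    have hnoname : ∀ y ∈ I.1.1, y ∉ X := fun y hy hyX => by
      have hs1 := singleton_named_of_reach cgSel_mem hR y hyX hy
      have h1 := card_smallestCell_le I.1.2 hy
      rw [hs1, card_singleton] at h1
      omega
    -- old points differ from the new one
    have hneX : ∀ y ∈ X, y ≠ cgSel I := fun y hy he => hfresh (he ▸ hy)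
    intro v hv
    have hvX : v ∉ X := hnoname v hv
    obtain ⟨t, x, hORc, hxv, hcol, hi, hX, hHC, hND⟩ := (ih v hv).1 hvX
    have htimed : timed G v (St G I₀ v) x t = I.1 := timed_eq_of_invData hconn hv hcol hi
    have hxX : ∀ k, k < t → x k ∈ X := fun k hk => by rw [hX]; exact mem_image_of_mem x (mem_range.2 hk)
    -- (C1′) for the new point against every earlier step of the path of `v`
    have hcross : ∀ k, k < t → cgSel I ∈ cellOf (timed G v (St G I₀ v) x k).1 (timed G v (St G I₀ v) x k).2 (x k) →
        hgt G cgSel I < lam (x k) := fun k hk hmem => by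
      obtain ⟨ν, A', ch', X', lam', hsν, hA', hlam, hRF⟩ := hND k hk
      rw [hlam]
      exact hgt_lt_of_reachFrom cgSel_mem ν A' ch' hsν hRF (hA' ▸ hmem)
    -- height-colouredness of any extension of the path by the new point
    have hHCext : ∀ x' : ℕ → V, (∀ k, k < t → x' k = x k) → x' t = cgSel I →
        (∀ k, k ≤ t → timed G v (St G I₀ v) x' k = timed G v (St G I₀ v) x k) →
        HeightColoured G v (St G I₀ v) x' (t + 1) (Function.update lam (cgSel I) (hgt G cgSel I)) := by
      intro x' hagx hxt hagree k i hki hi hmem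
      have hkt : k < t := by omega
      rw [hagree k hkt.le, hagx k hkt] at hmem
      rw [hagx k hkt, Function.update_of_ne (hneX _ (hxX k hkt))]
      rcases Nat.lt_succ_iff_lt_or_eq.1 hi with hit | hit
      · rw [hagx i hit] at hmem ⊢
        rw [Function.update_of_ne (hneX _ (hxX i hit))]
        exact hHC k i hki hit hmem
      · rw [hit, hxt] at hmem ⊢
        rw [Function.update_self]
        exact hcross k hkt hmem
    refine ⟨fun hvX' => ?_, fun hvX' => ?_⟩
    · -- `v` stays unnamed: extend its path by the new OR-choice
      rw [mem_insert, not_or] at hvX'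
      have h2 : 2 ≤ (timed G v (St G I₀ v) x t).1.card := by rw [htimed]; exact hOR.1
      have hz : cgSel I ∈ smallestCell (timed G v (St G I₀ v) x t).1 (timed G v (St G I₀ v) x t).2 := by rw [htimed]; exact hx₀A
      obtain ⟨x', hagx, hxt, hORc', hxv', hagree⟩ := isORChoice_extend hORc hxv h2 hz (Ne.symm hvX'.1)
      refine ⟨t + 1, x', hORc', hxv', ?_, ⟨0, ?_⟩, insert_eq_image_range_succ hagx hxt hX, hHCext x' hagx hxt hagree, ?_⟩
      · show refineIn G I.1.1 (indiv I.1.2 (cgSel I)) = (timed G v (St G I₀ v) x' (t + 1)).2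
        rw [timed_succ, hagree t le_rfl, htimed, hxt]
        rfl
      · show I.1.1 = (timed G v (St G I₀ v) x' t).1
        rw [hagree t le_rfl, htimed]
      · intro k hk
        rcases Nat.lt_succ_iff_lt_or_eq.1 hk with hkt | hkt
        · obtain ⟨ν, A', ch', X', lam', hsν, hA', hlam, hRF⟩ := hND k hkt
          refine ⟨ν, A', ch', X', lam', hsν, ?_, ?_, hRF.snoc_child hs⟩
          · rw [hagree k hkt.le, hagx k hkt]; exact hA'
          · rw [hagx k hkt, Function.update_of_ne (hneX _ (hxX k hkt))]; exact hlam
        · subst hkt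
          refine ⟨I, smallestCell I.1.1 I.1.2, cgChild G I, insert (cgSel I) X, Function.update lam (cgSel I) (hgt G cgSel I), hs,
            ?_, ?_, CertifiedLabels.ReachFrom.refl⟩
          · rw [hagree k le_rfl, htimed, hxt]; exact smallestCell_eq_cellOf I.1.2 hx₀A
          · rw [hxt, Function.update_self]
    · -- `v` has just been named: `v = cgSel I`
      rw [mem_insert] at hvX'
      rcases hvX' with hvx | hvx
      · subst hvx
        have hagx : ∀ k, k < t → (if k < t then x k else cgSel I) = x k := fun k hk => if_pos hk
        have hxt : (if t < t then x t else cgSel I) = cgSel I := if_neg (lt_irrefl t)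
        have hagree : ∀ k, k ≤ t → timed G (cgSel I) (St G I₀ (cgSel I)) (fun k => if k < t then x k else cgSel I) k =
            timed G (cgSel I) (St G I₀ (cgSel I)) x k := fun k hk => timed_congr fun j hj => hagx j (hj.trans_le hk)
        refine ⟨t, fun k => if k < t then x k else cgSel I, fun k hk => ?_, hxt, fun k hk => ?_, ?_, ?_,
          insert_eq_image_range_succ hagx hxt hX, hHCext _ hagx hxt hagree⟩
        · dsimp only
          rcases Nat.lt_succ_iff_lt_or_eq.1 hk with hkt | hkt
          · rw [hagree k hkt.le, hagx k hkt]; exact hORc k hkt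
          · subst hkt; rw [hagree k le_rfl, hxt, htimed]; exact ⟨hOR.1, hx₀A⟩
        · dsimp only; rw [hagx k hk]; exact hxv k hk
        · show refineIn G I.1.1 (indiv I.1.2 (cgSel I)) = (timed G (cgSel I) (St G I₀ (cgSel I)) _ (t + 1)).2
          rw [timed_succ, hagree t le_rfl, htimed, hxt]
          rfl
        · show I.1.1 ⊆ (timed G (cgSel I) (St G I₀ (cgSel I)) _ t).1
          rw [hagree t le_rfl, htimed]
      · exact absurd hvx hvX

/-! ### The runs of the pointers of a reached block -/

/-- **Unnamed pointer**: the run of `v ∈ I.1.1 ∖ X` with fuel `≥ |V|` ends at `(atom of v in I, colouring of I)`. -/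
theorem reach_replay_eq_of_not_mem {I : (cgProcess G).Inst} {X : Finset V} {lam : V → ℕ}
    (h : CertifiedLabels.Reach (cgProcess G) (cgSel (V := V)) (hgt G cgSel) I₀ I X lam) {v : V} (hv : v ∈ I.1.1) (hvX : v ∉ X)
    {F : ℕ} (hF : Fintype.card V ≤ F) : replay G X lam v F (St G I₀ v) = (atom G I.1.1 I.1.2 v, I.1.2) := by
  obtain ⟨t, x, hORc, hxv, hcol, ⟨i, hi⟩, hX, hHC, -⟩ := (reach_pointer h v hv).1 hvX
  have ht : t ≤ F := (length_le_card hORc hxv).trans hF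
  rw [hX, replay_root hORc hxv hHC ht]
  refine Prod.ext ?_ hcol.symm
  change (timed G v (St G I₀ v) x t).1 = atom G I.1.1 I.1.2 v
  rw [timed_fst_eq_atom, ← hcol, hi, atom_iterate]

/-- **Named pointer**: the run of `v ∈ I.1.1 ∩ X` with fuel `≥ |V|` has just individualised `v` and sits at `({v}, colouring of I)`. -/
theorem reach_replay_eq_of_mem {I : (cgProcess G).Inst} {X : Finset V} {lam : V → ℕ}
    (h : CertifiedLabels.Reach (cgProcess G) (cgSel (V := V)) (hgt G cgSel) I₀ I X lam) {v : V} (hv : v ∈ I.1.1) (hvX : v ∈ X)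
    {F : ℕ} (hF : Fintype.card V ≤ F) : replay G X lam v F (St G I₀ v) = ({v}, I.1.2) := by
  obtain ⟨t, x, hORc, hxt, hxv, hcol, -, hX, hHC⟩ := (reach_pointer h v hv).2 hvX
  have hORt : IsORChoice G v (St G I₀ v) x t := fun k hk => hORc k (Nat.lt_succ_of_lt hk)
  -- the `t + 1` choices are distinct vertices
  have hinj : Set.InjOn x ↑(range (t + 1)) := by
    intro i hi j hj hij
    have hi' := mem_range.1 (mem_coe.1 hi)
    have hj' := mem_range.1 (mem_coe.1 hj)
    rcases Nat.lt_succ_iff_lt_or_eq.1 hi' with hit | hit <;> rcases Nat.lt_succ_iff_lt_or_eq.1 hj' with hjt | hjt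
    · exact x_injective hORt hxv hit hjt hij
    · exact absurd (hij.trans (by rw [hjt]; exact hxt)) (hxv i hit)
    · exact absurd (hij.symm.trans (by rw [hit]; exact hxt)) (hxv j hjt)
    · rw [hit, hjt]
  have hcard : t + 1 ≤ Fintype.card V := by
    have := card_le_univ ((range (t + 1)).image x)
    rwa [card_image_of_injOn hinj, card_range] at this
  have hv' : ∀ k, k + 1 < t + 1 → x k ≠ v := fun k hk => hxv k (by omega)
  have hvI₀ : v ∈ I₀.1.1 := block_subset_of_reach h hv
  have hvB : v ∈ (timed G v (St G I₀ v) x t).1 := self_mem_timed (self_mem_atom I₀.1.2 hvI₀) t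
  have hrun : replay G X lam v (t + 1) (St G I₀ v) = ({v}, I.1.2) := by
    rw [hX, replay_eq_timed_of_last hORc hv' hHC]
    refine Prod.ext ?_ hcol.symm
    rw [timed_succ, hxt]
    exact atom_refineIn_indiv_self _ hvB
  rw [replay_eq_of_le (hcard.trans hF) _ (by rw [hrun]; exact fun hc => absurd hc.1 (by simp)), hrun]

/-- **Every pointer of a reached block runs to the colouring of the block**: for every label `(I, X, λ)` of the solution subtree, every
`v ∈ I.1.1` and every fuel `F ≥ |V|`, `(replay G X λ v F (St G I₀ v)).2 = I.1.2`. -/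
theorem reach_replay_snd_eq {I : (cgProcess G).Inst} {X : Finset V} {lam : V → ℕ}
    (h : CertifiedLabels.Reach (cgProcess G) (cgSel (V := V)) (hgt G cgSel) I₀ I X lam) {v : V} (hv : v ∈ I.1.1)
    {F : ℕ} (hF : Fintype.card V ≤ F) : (replay G X lam v F (St G I₀ v)).2 = I.1.2 := by
  by_cases hvX : v ∈ X
  · rw [reach_replay_eq_of_mem h hv hvX hF]
  · rw [reach_replay_eq_of_not_mem h hv hvX hF]

/-- … and its final block contains the pointer and lies inside the block of the label. -/
theorem reach_replay_fst {I : (cgProcess G).Inst} {X : Finset V} {lam : V → ℕ}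
    (h : CertifiedLabels.Reach (cgProcess G) (cgSel (V := V)) (hgt G cgSel) I₀ I X lam) {v : V} (hv : v ∈ I.1.1)
    {F : ℕ} (hF : Fintype.card V ≤ F) : v ∈ (replay G X lam v F (St G I₀ v)).1 ∧ (replay G X lam v F (St G I₀ v)).1 ⊆ I.1.1 := by
  by_cases hvX : v ∈ X
  · rw [reach_replay_eq_of_mem h hv hvX hF]
    exact ⟨mem_singleton_self v, singleton_subset_iff.2 hv⟩
  · rw [reach_replay_eq_of_not_mem h hv hvX hF]
    exact ⟨self_mem_atom _ hv, atom_subset _ _ _⟩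

end Pointer

end BranchSum

end Summit.PneNP.PneNP.Theorems
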